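import Literature.NumberTheory.LFunctions.XiLadderTailInputs
import Literature.NumberTheory.LFunctions.XiTiltedSecondMoment
import HarnessLib

/-!
# The second-moment law `16·M_{2n+2} ≤ log² n · M_{2n}` of the Pólya–de Bruijn moments, `n ≥ 10⁵`

`Literature/NumberTheory/LFunctions/`. For the moments `M_k = ∫₀^∞ Φ(u)uᵏ du` (`xiMoment`) of the
Pólya–de Bruijn kernel — equivalently for the Taylor coefficients `γ(n) = 64·4ⁿn!/(2n)!·M_{2n}` of `ξ`
(`xiTaylorCoeff_eq_xiMoment`), `16(n+½)γ(n+1) ≤ log² n · γ(n)` — this file proves, for every `n ≥ 10⁵`,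

  `16 · M_{2n+2} ≤ log² n · M_{2n}`,  i.e.  `E_{ν_{2n}}[u²] ≤ (log n / 4)²`  (`xiMoment_ratio_le_log_sq`),

height-free and zero-free: the tilted law `ν_{2n} ∝ u^{2n}Φ(u)du` has mode `a ≤ (log n - 5/2)/4` (lower
envelope `-Φ′/Φ ≥ 4πe^{4u} - 9.005`, tree) and is concentrated at `a` within `√B ≤ 1/460`
(Brascamp–Lieb with the two-piece curvature floor, left mass negligible — the chain of `XiLadderMuTwo.lean`,
reused verbatim for `n ≥ 10⁵`: mode `≥ 17/8`, bulk floor `16πe^{4(a-1/40)}`), whence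
`E[u²] = ū²(1 + m₂) ≤ (a + √B)² + B ≤ (log n/4)²`. This is the support statement S-HJ2(10⁵)
(`XiMomentRatioLog16 100000`) of the JENSEN column's Hermite–Jensen threshold law (cell rh-jensen):
with O'Sullivan's Turán-certificate route it yields `P^{d,n}_ξ` hyperbolic for `n ≥ 10⁵`,
`d³ log⁸ n ≤ 2¹⁹(n+½)⁴`.

References: Griffin–Ono–Rolen–Zagier, PNAS 116 (2019), Thm 7 / §5.1 [GORZPNAS2019];
Brascamp–Lieb, J. Funct. Anal. 22 (1976), Thm 4.1 [BrascampLieb1976]; Coffey–Csordas, Math. Comp. 82 (2013),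
Prop. 2.1 / Thm 2.4 [CoffeyCsordas2013].
-/

noncomputable section

open MeasureTheory Set Filter
open scoped Topology

namespace Literature.NumberTheory.LFunctions

open Literature.Probability.Distributions

/-! ### Numerical constants -/

/-- `e^8 < 2981`. [folklore] -/
private theorem exp_eight_lt : Real.exp 8 < 2981 := by
  have h := Real.exp_one_lt_d9
  have e : Real.exp 8 = Real.exp 1 ^ 8 := by rw [← Real.exp_nat_mul]; norm_num
  rw [e]
  calc Real.exp 1 ^ 8 < 2.7182818286 ^ 8 := pow_lt_pow_left₀ h (Real.exp_pos 1).le (by norm_num)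
    _ < 2981 := by norm_num

/-- `2980.9 < e^8`. [folklore] -/
private theorem exp_eight_gt : 2980.9 < Real.exp 8 := by
  have h := Real.exp_one_gt_d9
  have e : Real.exp 8 = Real.exp 1 ^ 8 := by rw [← Real.exp_nat_mul]; norm_num
  rw [e]
  calc (2980.9 : ℝ) < 2.7182818283 ^ 8 := by norm_num
    _ < Real.exp 1 ^ 8 := pow_lt_pow_left₀ h (by norm_num) (by norm_num)

/-- `e^{1/2} ≤ 2` (from `1/2 ≤ e^{−1/2}`). [folklore] -/
private theorem exp_half_le_two : Real.exp (1 / 2) ≤ 2 := by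
  have h : -(1 / 2 : ℝ) + 1 ≤ Real.exp (-(1 / 2)) := Real.add_one_le_exp _
  have e : Real.exp (1 / 2) * Real.exp (-(1 / 2)) = 1 := by rw [← Real.exp_add]; norm_num
  nlinarith [Real.exp_pos (1 / 2 : ℝ), Real.exp_pos (-(1 / 2) : ℝ)]

/-- `e^{17/2} < 5962` and `4843 < e^{17/2}`. [folklore] -/
private theorem exp_seventeen_half_bounds : 4843 < Real.exp (17 / 2) ∧ Real.exp (17 / 2) < 5962 := by
  have e : Real.exp (17 / 2) = Real.exp 8 * Real.exp (1 / 2) := by rw [← Real.exp_add]; norm_num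
  rw [e]
  have h1 := exp_eight_lt
  have h2 := exp_eight_gt
  have h3 := exp_half_le_two
  have h4 : (13 : ℝ) / 8 ≤ Real.exp (1 / 2) := by
    have := Real.quadratic_le_exp_of_nonneg (show (0 : ℝ) ≤ 1 / 2 by norm_num)
    linarith
  constructor <;> nlinarith [Real.exp_pos (8 : ℝ), Real.exp_pos (1 / 2 : ℝ)]

/-- `9/10 ≤ e^{−1/10}` and `e^{1/20} ≤ 20/19`. [folklore] -/
private theorem exp_small_bounds : (9 : ℝ) / 10 ≤ Real.exp (-(1 / 10)) ∧ Real.exp (1 / 20) ≤ 20 / 19 := by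
  constructor
  · have h := Real.add_one_le_exp (-(1 / 10) : ℝ); linarith
  · have h : -(1 / 20 : ℝ) + 1 ≤ Real.exp (-(1 / 20)) := Real.add_one_le_exp _
    have e : Real.exp (1 / 20) * Real.exp (-(1 / 20)) = 1 := by rw [← Real.exp_add]; norm_num
    nlinarith [Real.exp_pos (1 / 20 : ℝ), Real.exp_pos (-(1 / 20) : ℝ)]

/-- `e^{−45} ≤ 120/45⁵` (`x⁵/5! ≤ e^x`). [folklore] -/
private theorem exp_neg_45_le : Real.exp (-45) ≤ 120 / 45 ^ 5 := by
  have h := Real.pow_div_factorial_le_exp (45 : ℝ) (by norm_num) 5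
  have h5 : ((Nat.factorial 5 : ℕ) : ℝ) = 120 := by norm_num [Nat.factorial]
  rw [h5] at h
  rw [Real.exp_neg, inv_eq_one_div, div_le_div_iff₀ (Real.exp_pos 45) (by norm_num)]
  linarith

/-- Monotonicity used for uniformity in the mode: `a/(a − s)² ≤ α/(α − s)²` for `0 ≤ s < α ≤ a`.
[folklore] -/
private theorem div_sub_sq_le {a α s : ℝ} (hs0 : 0 ≤ s) (hs : s < α) (ha : α ≤ a) :
    a / (a - s) ^ 2 ≤ α / (α - s) ^ 2 := by
  have h1 : 0 < (a - s) ^ 2 := pow_pos (by linarith) 2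
  have h2 : 0 < (α - s) ^ 2 := pow_pos (by linarith) 2
  rw [div_le_div_iff₀ h1 h2]
  have key : α * (a - s) ^ 2 - a * (α - s) ^ 2 = (a - α) * (a * α - s ^ 2) := by ring
  have hs2 : s ^ 2 ≤ α ^ 2 := pow_le_pow_left₀ hs0 hs.le 2
  have hα2 : α ^ 2 ≤ a * α := by nlinarith
  have h3 : 0 ≤ (a - α) * (a * α - s ^ 2) := mul_nonneg (by linarith) (by linarith)
  linarith

/-- `e^{5/2} ≤ 25/2`. [folklore] -/
private theorem exp_five_half_le : Real.exp (5 / 2) ≤ 25 / 2 := by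
  have e : Real.exp (5 / 2) = Real.exp 1 ^ 2 * Real.exp (1 / 2) := by
    rw [← Real.exp_nat_mul, ← Real.exp_add]; norm_num
  rw [e]
  have h := Real.exp_one_lt_d9
  have h2 : Real.exp 1 ^ 2 ≤ 2.7182818286 ^ 2 := pow_le_pow_left₀ (Real.exp_pos 1).le h.le 2
  have h3 : Real.exp (1 / 2) ≤ 1.65 := by
    have e2 : Real.exp 1 = Real.exp (1 / 2) ^ 2 := by rw [← Real.exp_nat_mul]; norm_num
    nlinarith [Real.exp_pos (1 / 2 : ℝ)]
  calc Real.exp 1 ^ 2 * Real.exp (1 / 2) ≤ 2.7182818286 ^ 2 * 1.65 :=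
        mul_le_mul h2 h3 (Real.exp_pos _).le (by positivity)
    _ ≤ 25 / 2 := by norm_num

/-! ### The second-moment law -/

/-- **Concentration of `ν_{2n}` for `n ≥ 10⁵`** (the chain of `XiLadderMuTwo.lean`, exported): there is a
critical point `a ≥ 17/8` of the tilted potential and a number `B ≤ 1.0002/219081` with `m₂ū² ≤ B` and
`(ū − a)² ≤ B` (`ū = xiMean (2n)`, `m₂ = xiCM (2n) 2`). [cite: BrascampLieb1976, Thm 4.1 (n = 1)] -/
theorem xi_tilted_concentration (n : ℕ) (hn : 100000 ≤ n) :
    ∃ a B : ℝ, 17 / 8 ≤ a ∧ 2 * (n : ℝ) / a + deBruijnPhiDeriv a / deBruijnPhi a = 0 ∧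
      xiCM (2 * n) 2 * xiMean (2 * n) ^ 2 ≤ B ∧ (xiMean (2 * n) - a) ^ 2 ≤ B ∧
      B ≤ (1 + 1 / 5000) / 219081 := by
  have hπ := Real.pi_gt_d6
  have hπ' := Real.pi_lt_d6
  have hπ0 : 0 < Real.pi := Real.pi_pos
  obtain ⟨he_lo, he_hi⟩ := exp_seventeen_half_bounds
  obtain ⟨hexp_tenth, hexp_twentieth⟩ := exp_small_bounds
  have hn' : (100000 : ℝ) ≤ n := by exact_mod_cast hn
  -- Step A: the mode `a ≥ 17/8`
  have hcast : ((2 * n : ℕ) : ℝ) = 2 * (n : ℝ) := by push_cast; ring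
  have hbr : 4 * Real.pi * Real.exp (4 * (17 / 8 : ℝ)) - 9 < ((2 * n : ℕ) : ℝ) / (17 / 8) := by
    rw [hcast, show (4 : ℝ) * (17 / 8) = 17 / 2 by norm_num]
    have h1 : Real.pi * Real.exp (17 / 2) < 3.141593 * 5962 :=
      mul_lt_mul'' hπ' he_hi hπ0.le (Real.exp_pos _).le
    have h2 : (76000 : ℝ) ≤ 2 * (n : ℝ) / (17 / 8) := by
      rw [le_div_iff₀ (by norm_num : (0 : ℝ) < 17 / 8)]; linarith
    linarith
  obtain ⟨a, hαa, hmode⟩ := exists_xi_mode_ge (2 * n) (by norm_num : (0 : ℝ) < 17 / 8) hbr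
  rw [hcast] at hmode
  have ha : 0 < a := by linarith
  -- `Y = πe^{4a} ≥ 15214`
  set Y : ℝ := Real.pi * Real.exp (4 * a) with hY
  have hY0 : 0 < Y := by positivity
  have hYlo : 15214 ≤ Y := by
    have h1 : Real.exp (17 / 2) ≤ Real.exp (4 * a) := Real.exp_le_exp.2 (by linarith)
    have h2 : (3.141592 : ℝ) * 4843 ≤ Real.pi * Real.exp (4 * a) :=
      mul_le_mul hπ.le (by linarith) (by norm_num) hπ0.le
    rw [hY]; linarith
  -- the bulk floor `R = 16πe^{4(a − 1/40)} ≥ 14.4·Y`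
  set R : ℝ := 16 * Real.pi * Real.exp (4 * (a - 1 / 40)) with hR
  have hRge : (144 / 10) * Y ≤ R := by
    have e1 : Real.exp (4 * (a - 1 / 40)) = Real.exp (4 * a) * Real.exp (-(1 / 10)) := by
      rw [← Real.exp_add]; congr 1; ring
    have e : R = 16 * Y * Real.exp (-(1 / 10)) := by rw [hR, e1, hY]; ring
    rw [e]
    have := mul_le_mul_of_nonneg_left hexp_tenth (by positivity : (0 : ℝ) ≤ 16 * Y)
    linarith
  have hR0 : 0 < R := by positivity
  have hRlo : 219081 ≤ R := by linarith
  -- `2n ≤ a(4πe^{4a} − 9)`, hence `2n + 1 ≤ 4aY`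
  have hkY : 2 * (n : ℝ) + 1 ≤ 4 * a * Y := by
    have henv := neg_deBruijnPhiDeriv_div_le ha.le
    have e : -deBruijnPhiDeriv a / deBruijnPhi a = -(deBruijnPhiDeriv a / deBruijnPhi a) := neg_div _ _
    have h2 : 2 * (n : ℝ) / a ≤ 4 * Real.pi * Real.exp (4 * a) - 9 := by linarith
    rw [div_le_iff₀ ha] at h2
    have e2 : (4 * Real.pi * Real.exp (4 * a) - 9) * a = 4 * a * Y - 9 * a := by rw [hY]; ring
    rw [e2] at h2
    linarith
  have hk : 2 * (n : ℝ) ≤ 4 * a * Y := by linarith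
  -- Step B: floors
  have hfloor : ∀ u : ℝ, 0 < u → a - 1 / 40 ≤ u → R ≤ 2 * (n : ℝ) / u ^ 2 +
      (deBruijnPhiDeriv u ^ 2 - deBruijnPhi u * deBruijnPhiDeriv₂ u) / deBruijnPhi u ^ 2 := by
    intro u hu hbu
    have h1 := xi_curvature_lower (2 * n) hu
    rw [hcast] at h1
    have h2 : Real.exp (4 * (a - 1 / 40)) ≤ Real.exp (4 * u) := Real.exp_le_exp.2 (by linarith)
    have h3 := mul_le_mul_of_nonneg_left h2 (by positivity : (0 : ℝ) ≤ 16 * Real.pi)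
    rw [hR]; linarith
  have hfloor' : ∀ u : ℝ, 0 < u → u < a - 1 / 40 → 16 * Real.pi ≤ 2 * (n : ℝ) / u ^ 2 +
      (deBruijnPhiDeriv u ^ 2 - deBruijnPhi u * deBruijnPhiDeriv₂ u) / deBruijnPhi u ^ 2 := by
    intro u hu _
    have h1 := xi_curvature_lower (2 * n) hu
    rw [hcast] at h1
    have h2 : (1 : ℝ) ≤ Real.exp (4 * u) := Real.one_le_exp (by linarith)
    have h3 := mul_le_mul_of_nonneg_left h2 (by positivity : (0 : ℝ) ≤ 16 * Real.pi)
    linarith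
  -- Step C: the left mass
  have hP := xi_leftMass_le (2 * n) (s := 1 / 80) (τ := 1 / 40) (a := a) (by norm_num) (by norm_num)
    (by linarith) (by linarith) (by rw [hcast]; exact hmode)
  rw [hcast] at hP
  set Λ : ℝ := 2 * (n : ℝ) / (a - 1 / 80) ^ 2 +
    16 * Real.pi * Real.exp (4 * (a + 1 / 80)) * (1 + 1 / 10 ^ 6) with hΛ
  -- exponent bound: `−R/3200 + Λ/12800 ≤ −45`
  have hΛle : Λ ≤ (188423 / 10000) * Y := by
    have hmon := div_sub_sq_le (s := 1 / 80) (α := 17 / 8) (a := a) (by norm_num) (by norm_num) hαa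
    have hpos : 0 < (a - 1 / 80) ^ 2 := pow_pos (by linarith) 2
    have hc : (17 / 8 : ℝ) / (17 / 8 - 1 / 80) ^ 2 ≤ 1 / 2 := by norm_num
    have h1 : 2 * (n : ℝ) / (a - 1 / 80) ^ 2 ≤ 2 * Y := by
      calc 2 * (n : ℝ) / (a - 1 / 80) ^ 2 ≤ 4 * a * Y / (a - 1 / 80) ^ 2 :=
            div_le_div_of_nonneg_right hk hpos.le
        _ = 4 * Y * (a / (a - 1 / 80) ^ 2) := by ring
        _ ≤ 4 * Y * (1 / 2) := mul_le_mul_of_nonneg_left (hmon.trans hc) (by positivity)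
        _ = 2 * Y := by ring
    have h2 : Real.exp (4 * (a + 1 / 80)) ≤ Real.exp (4 * a) * (20 / 19) := by
      have e : Real.exp (4 * (a + 1 / 80)) = Real.exp (4 * a) * Real.exp (1 / 20) := by
        rw [← Real.exp_add]; congr 1; ring
      rw [e]; exact mul_le_mul_of_nonneg_left hexp_twentieth (Real.exp_pos _).le
    have h3 : 16 * Real.pi * Real.exp (4 * (a + 1 / 80)) * (1 + 1 / 10 ^ 6) ≤
        16 * (20 / 19) * (1 + 1 / 10 ^ 6) * Y := by
      calc 16 * Real.pi * Real.exp (4 * (a + 1 / 80)) * (1 + 1 / 10 ^ 6)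
          = 16 * Real.pi * (1 + 1 / 10 ^ 6) * Real.exp (4 * (a + 1 / 80)) := by ring
        _ ≤ 16 * Real.pi * (1 + 1 / 10 ^ 6) * (Real.exp (4 * a) * (20 / 19)) :=
            mul_le_mul_of_nonneg_left h2 (by positivity)
        _ = 16 * (20 / 19) * (1 + 1 / 10 ^ 6) * Y := by rw [hY]; ring
    have e : Λ = 2 * (n : ℝ) / (a - 1 / 80) ^ 2 +
        16 * Real.pi * Real.exp (4 * (a + 1 / 80)) * (1 + 1 / 10 ^ 6) := hΛ
    rw [e]
    linarith
  have hE : -(R * (1 / 40) ^ 2 / 2) + Λ * (1 / 80) ^ 2 / 2 ≤ -45 := by linarith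
  have hexpE : Real.exp (-(R * (1 / 40) ^ 2 / 2)) * Real.exp (Λ * (1 / 80) ^ 2 / 2) ≤ 120 / 45 ^ 5 := by
    rw [← Real.exp_add]
    exact (Real.exp_le_exp.2 hE).trans exp_neg_45_le
  have hP' : (∫ u in Ioo 0 (a - 1 / 40), deBruijnPhi u * u ^ (2 * n)) / xiMoment (2 * n) ≤
      (120 / 45 ^ 5) * 1600 / R := by
    refine hP.trans ?_
    have hden : 0 < 2 * (1 / 80 : ℝ) * R * (1 / 40) := by positivity
    calc Real.exp (-(R * (1 / 40) ^ 2 / 2)) * Real.exp (Λ * (1 / 80) ^ 2 / 2) /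
          (2 * (1 / 80) * R * (1 / 40))
        ≤ (120 / 45 ^ 5) / (2 * (1 / 80) * R * (1 / 40)) := div_le_div_of_nonneg_right hexpE hden.le
      _ = (120 / 45 ^ 5) * 1600 / R := by field_simp; ring
  -- Step D: `B = (1 + 1/5000)/R`
  set B : ℝ := (1 + 1 / 5000) / R with hB
  have hB0 : 0 < B := by positivity
  have hBineq : R⁻¹ + (16 * Real.pi)⁻¹ *
      ((∫ u in Ioo 0 (a - 1 / 40), deBruijnPhi u * u ^ (2 * n)) / xiMoment (2 * n)) ≤ B := by
    have h1 : (16 * Real.pi)⁻¹ *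
        ((∫ u in Ioo 0 (a - 1 / 40), deBruijnPhi u * u ^ (2 * n)) / xiMoment (2 * n)) ≤
        (16 * Real.pi)⁻¹ * ((120 / 45 ^ 5) * 1600 / R) :=
      mul_le_mul_of_nonneg_left hP' (by positivity)
    have hc : (120 / 45 ^ 5 * 1600 : ℝ) / (16 * Real.pi) ≤ 1 / 5000 := by
      rw [div_le_iff₀ (by positivity)]; norm_num; nlinarith [hπ]
    have h2 : (16 * Real.pi)⁻¹ * ((120 / 45 ^ 5) * 1600 / R) ≤ (1 / 5000) / R := by
      have e : (16 * Real.pi)⁻¹ * ((120 / 45 ^ 5) * 1600 / R) =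
          ((120 / 45 ^ 5 * 1600) / (16 * Real.pi)) * R⁻¹ := by
        rw [div_eq_mul_inv _ R, div_eq_mul_inv _ (16 * Real.pi)]; ring
      rw [e, div_eq_mul_inv (1 / 5000) R]
      exact mul_le_mul_of_nonneg_right hc (inv_nonneg.2 hR0.le)
    have e : B = R⁻¹ + (1 / 5000) / R := by rw [hB]; field_simp
    rw [e]; linarith
  have hBle : B ≤ (1 + 1 / 5000) / 219081 := by
    rw [hB]; exact div_le_div_of_nonneg_left (by norm_num) (by norm_num) hRlo
  have hsqrtB : Real.sqrt B < 1 / 460 := by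
    rw [show (1 / 460 : ℝ) = Real.sqrt ((1 / 460) ^ 2) by rw [Real.sqrt_sq (by norm_num)]]
    exact Real.sqrt_lt_sqrt hB0.le (by linarith)
  have hBa : Real.sqrt B < a := by linarith
  -- the Brascamp–Lieb bounds for the variance and the mean
  obtain ⟨hcm, hmean⟩ := xiCM_two_mul_sq_xiMean_le (2 * n) ha (by rw [hcast]; exact hmode) hR0
    (by positivity : (0 : ℝ) < 16 * Real.pi) (fun u hu hbu => by rw [hcast]; exact hfloor u hu hbu)
    (fun u hu hub => by rw [hcast]; exact hfloor' u hu hub)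
  exact ⟨a, B, hαa, hmode, hcm.trans hBineq, hmean.trans hBineq, hBle⟩

/-- **`16·M_{2n+2} ≤ log² n · M_{2n}` for every `n ≥ 10⁵`** (`E_{ν_{2n}}[u²] ≤ (log n/4)²`), height-free
and zero-free: `E[u²] = ū²(1 + m₂) ≤ (a + 1/460)² + B` by the concentration lemma, and `4a + 5/2 ≤ log n`
by the lower envelope of `−Φ′/Φ` at the mode (`e^{5/2} ≤ 12.5 ≤ 4π`). [cite: GORZPNAS2019, Thm 7 and §5.1] -/
theorem xiMoment_ratio_le_log_sq (n : ℕ) (hn : 100000 ≤ n) :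
    16 * xiMoment (2 * n + 2) ≤ Real.log n ^ 2 * xiMoment (2 * n) := by
  obtain ⟨a, B, hαa, hmode, hcmB, hmeanB, hBle⟩ := xi_tilted_concentration n hn
  have hn' : (100000 : ℝ) ≤ n := by exact_mod_cast hn
  have ha : 0 < a := by linarith
  have hsB0 : 0 ≤ Real.sqrt B := Real.sqrt_nonneg _
  have hB0 : 0 ≤ B := le_trans (sq_nonneg _) hmeanB
  have hsqrtB : Real.sqrt B ≤ 1 / 460 := by
    rw [Real.sqrt_le_left (by norm_num)]; exact hBle.trans (by norm_num)
  have habs : |xiMean (2 * n) - a| ≤ Real.sqrt B := by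
    rw [← Real.sqrt_sq_eq_abs]; exact Real.sqrt_le_sqrt hmeanB
  have hūle : xiMean (2 * n) ≤ a + 1 / 460 := by
    have := le_abs_self (xiMean (2 * n) - a); linarith
  have hū0 : 0 ≤ xiMean (2 * n) := (xiMean_pos _).le
  -- `E[u²] = M_{2n+2}/M_{2n} = ū² + m₂ū² ≤ (a + 1/460)² + B`
  have hE : xiMoment (2 * n + 2) / xiMoment (2 * n) =
      xiMean (2 * n) ^ 2 + xiCM (2 * n) 2 * xiMean (2 * n) ^ 2 := by
    have h := xiMoment_add_div (2 * n) 2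
    rw [Finset.sum_range_succ, Finset.sum_range_succ, Finset.sum_range_one, xiCM_zero, xiCM_one] at h
    rw [h]; norm_num [Nat.choose]; ring
  have hM := xiMoment_pos (2 * n)
  have hEle : xiMoment (2 * n + 2) / xiMoment (2 * n) ≤ (a + 1 / 460) ^ 2 + B := by
    rw [hE]
    have : xiMean (2 * n) ^ 2 ≤ (a + 1 / 460) ^ 2 := pow_le_pow_left₀ hū0 hūle 2
    linarith
  -- the mode from above: `4a + 5/2 ≤ log n`
  have ha32 : (3 : ℝ) / 2 ≤ a := by linarith
  have hlow := le_neg_deBruijnPhiDeriv_div ha32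
  have hLa : -deBruijnPhiDeriv a / deBruijnPhi a = 2 * (n : ℝ) / a := by
    have e : -deBruijnPhiDeriv a / deBruijnPhi a = -(deBruijnPhiDeriv a / deBruijnPhi a) := neg_div _ _
    rw [e]; linarith
  rw [hLa] at hlow
  have h2na : 2 * (n : ℝ) / a ≤ 16 / 17 * n := by
    have h := div_le_div_of_nonneg_left (by positivity : (0:ℝ) ≤ 2 * n) (by norm_num : (0:ℝ) < 17 / 8) hαa
    have e : 2 * (n : ℝ) / (17 / 8) = 16 / 17 * n := by ring
    linarith [e]
  have hπ : (25 : ℝ) / 2 ≤ 4 * Real.pi := by have := Real.pi_gt_d6; linarith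
  have hexp4a : Real.exp (4 * a) * (25 / 2) ≤ n := by
    have h1 := mul_le_mul_of_nonneg_left hπ (Real.exp_pos (4 * a)).le
    have e : Real.exp (4 * a) * (4 * Real.pi) = 4 * Real.pi * Real.exp (4 * a) := by ring
    linarith
  have hlog : 4 * a + 5 / 2 ≤ Real.log n := by
    rw [Real.le_log_iff_exp_le (by linarith), Real.exp_add]
    calc Real.exp (4 * a) * Real.exp (5 / 2) ≤ Real.exp (4 * a) * (25 / 2) :=
          mul_le_mul_of_nonneg_left exp_five_half_le (Real.exp_pos _).le
      _ ≤ n := hexp4a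
  -- conclude: `16((a + 1/460)² + B) ≤ (4a + 5/2)² ≤ log² n`
  have hBsmall : B ≤ 1 / 200000 := hBle.trans (by norm_num)
  have hfin : 16 * ((a + 1 / 460) ^ 2 + B) ≤ (4 * a + 5 / 2) ^ 2 := by
    have e : (4 * a + 5 / 2) ^ 2 - 16 * ((a + 1 / 460) ^ 2 + B) =
        (20 - 32 / 460) * a + (25 / 4 - 16 / 460 ^ 2) - 16 * B := by ring
    nlinarith [e]
  have hsq : (4 * a + 5 / 2) ^ 2 ≤ Real.log n ^ 2 := pow_le_pow_left₀ (by linarith) hlog 2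
  have key : 16 * (xiMoment (2 * n + 2) / xiMoment (2 * n)) ≤ Real.log n ^ 2 := by
    have := mul_le_mul_of_nonneg_left hEle (by norm_num : (0 : ℝ) ≤ 16)
    linarith
  have := mul_le_mul_of_nonneg_right key hM.le
  rw [mul_assoc, div_mul_cancel₀ _ hM.ne'] at this
  exact this

end Literature.NumberTheory.LFunctions
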